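import Mathlib
import Literature.RingTheory.KrullDimension.AffineDimension
import Summits.ResolutionOfSingularities.ResolutionOfSingularities.Theorems.WeightedInvariantGradedSimpleOrbitCharts
import Summits.ResolutionOfSingularities.ResolutionOfSingularities.Theorems.WeightedInvariantLaurentKrullDimension
import HarnessLib

/-!
# Dimension count on a torus chart: closed orbits with finite stabilisers are graded-simple

Route `ResolutionOfSingularities/WeightedInvariant`, door crux `HypersurfaceCentreConstruction`
(stmt-ResolutionOfSingularities-19897), e-ladder `e = 1` of `res-L1-w43-stub-10` (cell res-hironaka,
`D/res-D-pv-025/E1Skeleton.lean`, stub `stub_e1_inv_succ` «torus bookkeeping L1», clause (I2) of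
`ELadderOne.Stage.Inv`).  In the graded encoding of a torus action (a `ℤᵐ`-grading `𝒜` of the chart ring
`A = Γ(Y, W)`, `Theorems.GradedAtlas`: exponent `e ≥ 1`, homogeneous units of every degree `e • χ` near every
point = finite stabilisers) the chart ideal `P` of an orbit closure is a homogeneous prime, and the quotient
`A ⧸ P` contains a LAURENT POLYNOMIAL RING in `m` variables over the degree-`0` classes `A₀ ⧸ P₀` over which it is
integral.  Hence (pure commutative algebra; nothing here is a claim about Hironaka's problem):

* §2 `TorusChartDim.ringKrullDim_gradeZero_quotient_add_le` — for a `ℤᵐ`-graded commutative ring `A`, a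
  HOMOGENEOUS ideal `P` and homogeneous elements of the degrees `e • δᵢ` (`e ≠ 0`, `δᵢ` the coordinate vectors)
  that are units modulo `P`: `dim (A₀ ⧸ P₀) + m ≤ dim (A ⧸ P)`, where `A₀` is the degree-`0` subring and
  `P₀ = P ∩ A₀` (going-up along the integral extension `(A₀ ⧸ P₀)[ℤᵐ] ↪ A ⧸ P`,
  `Literature.RingTheory.KrullDimension.ringKrullDim_eq_of_isIntegral`, and `dim R + m ≤ dim R[ℤᵐ]` of
  `Theorems/WeightedInvariantLaurentKrullDimension.lean`); in particular `m ≤ dim (A ⧸ P)` for proper `P`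
  (`le_ringKrullDim_quotient`: an orbit of a torus acting with finite stabilisers has dimension `m`);
* §3 `TorusChartDim.isUnit_quotient_mk_of_degreeZero` — if moreover `P` is prime and `dim (A ⧸ P) ≤ m`, then
  `A₀ ⧸ P₀` is a zero-dimensional domain, i.e. a field: every degree-`0` element outside `P` is a unit modulo
  `P`; with res-type-047's criterion `gradedSimple_of_degreeZero_of_units`
  (`Theorems/WeightedInvariantGradedSimpleOrbitCharts.lean`) this gives
  `TorusChartDim.gradedSimple_of_ringKrullDim_le` — **an `m`-dimensional orbit closure on a torus chart with
  finite stabilisers is a closed orbit: its chart ideal has GRADED-SIMPLE quotient** (clause (I2) of the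
  invariant of rung `e = 1` from the dimension count (I1)).

AI-written; weaker than expert review.  No statement of H. Hironaka's manuscript is used.
-/

noncomputable section

open scoped nonZeroDivisors

set_option linter.dupNamespace false -- mandated namespace of this single-conjunct summit

namespace Summit.ResolutionOfSingularities.ResolutionOfSingularities.Theorems

/-! ## §2 Graded torus charts: the Laurent subring of `A ⧸ P` and the dimension count -/

namespace TorusChartDim

variable {m : ℕ} {A : Type*} [CommRing A] (𝒜 : (Fin m → ℤ) → AddSubgroup A) [GradedRing 𝒜]

/-- In a graded ring, a homogeneous element that is a unit modulo a HOMOGENEOUS ideal `P` has a homogeneous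
inverse modulo `P`, of the opposite degree (the degree-`0` component of `w y - 1 ∈ P` lies in `P`).
[folklore] -/
theorem exists_homogeneous_inverse {P : Ideal A} (hP : P.IsHomogeneous 𝒜) {d : Fin m → ℤ} {w : A}
    (hw : w ∈ 𝒜 d) (hu : IsUnit (Ideal.Quotient.mk P w)) :
    ∃ y ∈ 𝒜 (-d), w * y - 1 ∈ P := by
  classical
  obtain ⟨v, hv⟩ := hu.exists_right_inv
  obtain ⟨y, rfl⟩ := Ideal.Quotient.mk_surjective v
  rw [← map_mul, ← map_one (Ideal.Quotient.mk P), Ideal.Quotient.eq] at hv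
  refine ⟨DirectSum.decompose 𝒜 y (-d), SetLike.coe_mem _, ?_⟩
  have h0 : GradedRing.proj 𝒜 0 (w * y - 1) ∈ P := by
    rw [GradedRing.proj_apply]; exact hP 0 hv
  have h1 : GradedRing.proj 𝒜 0 (w * y) = w * DirectSum.decompose 𝒜 y (-d) := by
    rw [GradedRing.proj_apply]
    have := DirectSum.coe_decompose_mul_add_of_left_mem 𝒜 (b := y) (j := -d) hw
    rwa [add_neg_cancel] at this
  have h2 : GradedRing.proj 𝒜 0 (1 : A) = 1 := by
    rw [GradedRing.proj_apply, DirectSum.decompose_of_mem_same 𝒜 SetLike.GradedOne.one_mem]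
  rwa [map_sub, h1, h2] at h0

/-- Homogeneous representatives of all integer powers of a homogeneous unit modulo a homogeneous ideal.
[folklore] -/
theorem exists_homogeneous_zpow {P : Ideal A} (hP : P.IsHomogeneous 𝒜) {d : Fin m → ℤ} {w : A}
    (hw : w ∈ 𝒜 d) (hu : IsUnit (Ideal.Quotient.mk P w)) (n : ℤ) :
    ∃ v ∈ 𝒜 (n • d), Ideal.Quotient.mk P v = ((hu.unit ^ n : (A ⧸ P)ˣ) : A ⧸ P) := by
  obtain ⟨y, hy, hwy⟩ := exists_homogeneous_inverse 𝒜 hP hw hu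
  have hyinv : Ideal.Quotient.mk P y = ((hu.unit⁻¹ : (A ⧸ P)ˣ) : A ⧸ P) := by
    refine (Units.inv_eq_of_mul_eq_one_right ?_).symm
    rw [IsUnit.unit_spec, ← map_mul, ← map_one (Ideal.Quotient.mk P), Ideal.Quotient.eq]
    exact hwy
  cases n with
  | ofNat n =>
    refine ⟨w ^ n, ?_, ?_⟩
    · rw [Int.ofNat_eq_natCast, natCast_zsmul]
      exact SetLike.pow_mem_graded n hw
    · rw [map_pow, Int.ofNat_eq_natCast, zpow_natCast, Units.val_pow_eq_pow_val, IsUnit.unit_spec]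
  | negSucc n =>
    refine ⟨y ^ (n + 1), ?_, ?_⟩
    · have h := SetLike.pow_mem_graded (n + 1) hy
      have hdeg : Int.negSucc n • d = (n + 1) • (-d) := by
        rw [Int.negSucc_eq, neg_smul, smul_neg, ← natCast_zsmul]
        push_cast
        rfl
      rw [hdeg]
      exact h
    · rw [map_pow, hyinv, zpow_negSucc, ← inv_pow, Units.val_pow_eq_pow_val]

variable {𝒜} in
/-- The product of a family of homogeneous elements is homogeneous of the total degree. [folklore] -/
theorem prod_mem_graded {ι : Type*} (s : Finset ι) (deg : ι → Fin m → ℤ) (x : ι → A)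
    (hx : ∀ i ∈ s, x i ∈ 𝒜 (deg i)) : ∏ i ∈ s, x i ∈ 𝒜 (∑ i ∈ s, deg i) := by
  classical
  induction s using Finset.induction_on with
  | empty => simpa using SetLike.GradedOne.one_mem
  | insert a s ha ih =>
    rw [Finset.prod_insert ha, Finset.sum_insert ha]
    exact SetLike.mul_mem_graded (hx a (Finset.mem_insert_self a s))
      (ih fun i hi => hx i (Finset.mem_insert_of_mem hi))

/-- **The dimension count on a torus chart.**  Let `A` be a `ℤᵐ`-graded commutative ring, `P` a
homogeneous ideal, `e ≠ 0`, and suppose that for each coordinate vector `δᵢ` some homogeneous element of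
degree `e • δᵢ` is a unit modulo `P` (finite stabilisers).  Let `A₀` be the degree-`0` subring and
`P₀ = P ∩ A₀`.  Then `dim (A₀ ⧸ P₀) + m ≤ dim (A ⧸ P)`: the degree-`0` classes and the `m` units generate a
copy of the Laurent ring `(A₀ ⧸ P₀)[ℤᵐ]` inside `A ⧸ P` (distinct monomials have distinct degrees, `P` is
homogeneous), over which `A ⧸ P` is integral (`xᵉ` of a homogeneous `x` is a degree-`0` class times a unit
monomial); integral extensions preserve dimension and `dim R + m ≤ dim R[ℤᵐ]`. [folklore] -/
theorem ringKrullDim_gradeZero_quotient_add_le (P : Ideal A) (hP : P.IsHomogeneous 𝒜)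
    {e : ℕ} (he : e ≠ 0)
    (hu : ∀ i : Fin m, ∃ w ∈ 𝒜 (e • (Pi.single i 1 : Fin m → ℤ)), IsUnit (Ideal.Quotient.mk P w)) :
    ringKrullDim (↥(SetLike.GradeZero.subring 𝒜) ⧸
        P.comap (SetLike.GradeZero.subring 𝒜).subtype) + m ≤ ringKrullDim (A ⧸ P) := by
  classical
  -- notation
  set A₀ : Subring A := SetLike.GradeZero.subring 𝒜 with hA₀
  have memA₀ : ∀ {x : A}, x ∈ A₀ ↔ x ∈ 𝒜 0 := fun {x} => Iff.rfl
  set P₀ : Ideal A₀ := P.comap A₀.subtype with hP₀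
  let R := A₀ ⧸ P₀
  let B := A ⧸ P
  let mk : A →+* B := Ideal.Quotient.mk P
  -- the degree-0 classes embed
  let f : R →+* B := Ideal.quotientMap P A₀.subtype le_rfl
  have hf : Function.Injective f := Ideal.quotientMap_injective' le_rfl
  -- the units and their powers
  choose w hw hwu using hu
  let U : Fin m → Bˣ := fun i => (hwu i).unit
  let G : Multiplicative (Fin m → ℤ) →* B :=
    { toFun := fun χ => ∏ i, ((U i ^ (Multiplicative.toAdd χ i) : Bˣ) : B)
      map_one' := by simp
      map_mul' := fun χ χ' => by
        simp only [toAdd_mul, Pi.add_apply, zpow_add, Units.val_mul, Finset.prod_mul_distrib] }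
  have hGunit : ∀ χ, IsUnit (G χ) := fun χ => by
    have hG : G χ = ((∏ i, U i ^ (Multiplicative.toAdd χ i) : Bˣ) : B) := by
      simp only [G, MonoidHom.coe_mk, OneHom.coe_mk, Units.coe_prod]
    rw [hG]
    exact Units.isUnit _
  -- homogeneous representatives of the monomials
  have hGhom : ∀ χ : Fin m → ℤ, ∃ v ∈ 𝒜 (e • χ), mk v = G (Multiplicative.ofAdd χ) := by
    intro χ
    have hcoord : ∀ i, ∃ v ∈ 𝒜 (χ i • e • (Pi.single i 1 : Fin m → ℤ)),
        mk v = ((U i ^ (χ i) : Bˣ) : B) := fun i =>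
      exists_homogeneous_zpow 𝒜 hP (hw i) (hwu i) (χ i)
    choose v hv hvU using hcoord
    refine ⟨∏ i, v i, ?_, ?_⟩
    · have hmem := prod_mem_graded (𝒜 := 𝒜) Finset.univ (fun i => χ i • e • (Pi.single i 1 : Fin m → ℤ))
        v (fun i _ => hv i)
      have hdeg : ∑ i, χ i • e • (Pi.single i 1 : Fin m → ℤ) = e • χ := by
        ext j
        simp only [Finset.sum_apply, Pi.smul_apply, smul_eq_mul, Pi.single_apply]
        rw [Finset.sum_eq_single j]
        · simp; ring
        · intro i _ hij; simp [Ne.symm hij]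
        · intro h; exact absurd (Finset.mem_univ j) h
      rwa [hdeg] at hmem
    · simp only [map_prod, hvU, G, MonoidHom.coe_mk, OneHom.coe_mk, toAdd_ofAdd]
  choose v hv hvG using hGhom
  -- the Laurent ring and the evaluation map `ψ`
  let L := AddMonoidAlgebra R (Fin m → ℤ)
  let ψ : L →+* B := AddMonoidAlgebra.liftNCRingHom f G (fun _ _ => Commute.all _ _)
  have hψsingle : ∀ (χ : Fin m → ℤ) (c : A₀),
      ψ (AddMonoidAlgebra.single χ (Ideal.Quotient.mk P₀ c)) = mk ((c : A) * v χ) := by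
    intro χ c
    show AddMonoidAlgebra.liftNCRingHom f G _ (AddMonoidAlgebra.single χ _) = _
    rw [AddMonoidAlgebra.liftNCRingHom_single, map_mul, hvG]
    congr 1
  -- `ψ` is injective: read a relation degree by degree
  have hψinj : Function.Injective ψ := by
    rw [injective_iff_map_eq_zero]
    intro ℓ hℓ
    -- lift the coefficients to `A₀`
    have hlift : ∀ χ, ∃ c : A₀, Ideal.Quotient.mk P₀ c = ℓ.coeff χ := fun χ =>
      Ideal.Quotient.mk_surjective (ℓ.coeff χ)
    choose c hc using hlift
    -- `ℓ = ∑_{χ ∈ supp} single χ (mk c_χ)` and `ψ ℓ = mk (∑ c_χ v_χ)`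
    have hℓsum : ℓ = ∑ χ ∈ ℓ.coeff.support, AddMonoidAlgebra.single χ (Ideal.Quotient.mk P₀ (c χ)) := by
      simp_rw [hc]
      exact (AddMonoidAlgebra.sum_coeff_single ℓ).symm
    have hsum : mk (∑ χ ∈ ℓ.coeff.support, (c χ : A) * v χ) = 0 := by
      rw [hℓsum, map_sum] at hℓ
      simp only [hψsingle] at hℓ
      rwa [← map_sum] at hℓ
    rw [Ideal.Quotient.eq_zero_iff_mem] at hsum
    have hmemχ : ∀ χ, (c χ : A) * v χ ∈ 𝒜 (e • χ) := fun χ => by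
      simpa using SetLike.mul_mem_graded ((memA₀).mp (c χ).2) (hv χ)
    -- project to degree `e • χ₀`
    have hinj_e : Function.Injective fun χ : Fin m → ℤ => e • χ := smul_right_injective _ he
    have hcoeff : ∀ χ₀ ∈ ℓ.coeff.support, (c χ₀ : A) * v χ₀ ∈ P := by
      intro χ₀ hχ₀
      have hproj : GradedRing.proj 𝒜 (e • χ₀) (∑ χ ∈ ℓ.coeff.support, (c χ : A) * v χ) ∈ P := by
        rw [GradedRing.proj_apply]; exact hP _ hsum
      rw [map_sum, Finset.sum_eq_single χ₀] at hproj
      · rwa [GradedRing.proj_apply, DirectSum.decompose_of_mem_same 𝒜 (hmemχ χ₀)] at hproj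
      · intro χ _ hne
        rw [GradedRing.proj_apply, DirectSum.decompose_of_mem_ne 𝒜 (hmemχ χ)]
        exact fun h => hne (hinj_e h)
      · intro h; exact absurd hχ₀ h
    -- hence every coefficient vanishes
    have hzero : ∀ χ₀ ∈ ℓ.coeff.support, ℓ.coeff χ₀ = 0 := by
      intro χ₀ hχ₀
      have hunit : IsUnit (mk (v χ₀)) := by rw [hvG]; exact hGunit _
      have hcP : mk (c χ₀ : A) = 0 := by
        have h := (Ideal.Quotient.eq_zero_iff_mem).mpr (hcoeff χ₀ hχ₀)
        rw [map_mul] at h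
        exact (hunit.mul_left_eq_zero).mp h
      rw [← hc χ₀]
      have : f (Ideal.Quotient.mk P₀ (c χ₀)) = 0 := by
        show Ideal.quotientMap P A₀.subtype le_rfl (Ideal.Quotient.mk P₀ (c χ₀)) = 0
        rw [Ideal.quotientMap_mk]
        exact hcP
      exact (injective_iff_map_eq_zero f).mp hf _ this
    by_contra hne
    obtain ⟨χ₀, hχ₀⟩ : ℓ.coeff.support.Nonempty := by
      rw [Finsupp.support_nonempty_iff]
      intro h
      exact hne (AddMonoidAlgebra.coeff_injective (by rw [h]; rfl))
    exact (Finsupp.mem_support_iff.mp hχ₀) (hzero χ₀ hχ₀)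
  -- `B` is integral over `L` along `ψ`
  letI : Algebra L B := ψ.toAlgebra
  have hint : Algebra.IsIntegral L B := by
    refine ⟨fun b => ?_⟩
    obtain ⟨a, rfl⟩ := Ideal.Quotient.mk_surjective b
    rw [← DirectSum.sum_support_decompose 𝒜 a, map_sum]
    refine IsIntegral.sum _ fun χ _ => ?_
    -- a homogeneous element: `(mk x)^e = ψ (single χ c̄)` with `c = xᵉ · (inverse representative of v_χ)`
    set x : A := (DirectSum.decompose 𝒜 a χ : A) with hx
    have hxmem : x ∈ 𝒜 χ := SetLike.coe_mem _
    refine IsIntegral.of_pow (Nat.pos_of_ne_zero he) ?_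
    have hvunit : IsUnit (mk (v χ)) := by rw [hvG]; exact hGunit _
    obtain ⟨y, hy, hvy⟩ := exists_homogeneous_inverse 𝒜 hP (hv χ) hvunit
    have hc0 : x ^ e * y ∈ 𝒜 0 := by
      have := SetLike.mul_mem_graded (SetLike.pow_mem_graded e hxmem) hy
      rwa [add_neg_cancel] at this
    have hxe : (Ideal.Quotient.mk P x) ^ e =
        ψ (AddMonoidAlgebra.single χ (Ideal.Quotient.mk P₀ ⟨x ^ e * y, (memA₀).mpr hc0⟩)) := by
      rw [hψsingle, ← map_pow]
      change mk (x ^ e) = mk (x ^ e * y * v χ)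
      rw [Ideal.Quotient.eq]
      have : x ^ e - x ^ e * y * v χ = -(x ^ e * (v χ * y - 1)) := by ring
      rw [this]
      exact P.neg_mem (P.mul_mem_left _ hvy)
    rw [hxe]
    exact isIntegral_algebraMap
  -- conclude
  have hdim : ringKrullDim L = ringKrullDim B :=
    Literature.RingTheory.KrullDimension.ringKrullDim_eq_of_isIntegral (R := L) (S := B) hψinj
  calc ringKrullDim R + m ≤ ringKrullDim L := ringKrullDim_add_le_ringKrullDim_laurent R m
    _ = ringKrullDim B := hdim

/-- **An orbit with finite stabilisers has dimension `m`**: under the hypotheses of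
`ringKrullDim_gradeZero_quotient_add_le`, `m ≤ dim (A ⧸ P)`. [folklore] -/
theorem le_ringKrullDim_quotient (P : Ideal A) (hP : P.IsHomogeneous 𝒜) (hP1 : P ≠ ⊤)
    {e : ℕ} (he : e ≠ 0)
    (hu : ∀ i : Fin m, ∃ w ∈ 𝒜 (e • (Pi.single i 1 : Fin m → ℤ)), IsUnit (Ideal.Quotient.mk P w)) :
    (m : WithBot ℕ∞) ≤ ringKrullDim (A ⧸ P) := by
  have h := ringKrullDim_gradeZero_quotient_add_le 𝒜 P hP he hu
  have hnt : Nontrivial (↥(SetLike.GradeZero.subring 𝒜) ⧸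
      P.comap (SetLike.GradeZero.subring 𝒜).subtype) := by
    refine Ideal.Quotient.nontrivial_iff.mpr ?_
    rw [Ne, Ideal.comap_eq_top_iff]
    exact hP1
  have h0 : (0 : WithBot ℕ∞) ≤ ringKrullDim (↥(SetLike.GradeZero.subring 𝒜) ⧸
      P.comap (SetLike.GradeZero.subring 𝒜).subtype) := ringKrullDim_nonneg_of_nontrivial
  calc (m : WithBot ℕ∞) = 0 + m := by simp
    _ ≤ _ := by gcongr
    _ ≤ _ := h

/-! ## §3 Graded-simplicity from the dimension count -/

/-- **Degree-`0` classes form a field when the orbit closure has dimension `≤ m`.**  If `P` is a homogeneous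
PRIME with units modulo `P` of the degrees `e • δᵢ` and `dim (A ⧸ P) ≤ m`, then every degree-`0` element
outside `P` is a unit modulo `P`: `A₀ ⧸ P₀` is a domain with `dim (A₀ ⧸ P₀) + m ≤ m`, hence zero-dimensional,
hence a field (`Ring.KrullDimLE.isField_of_isDomain`). [folklore] -/
theorem isUnit_quotient_mk_of_degreeZero (P : Ideal A) [hPp : P.IsPrime] (hP : P.IsHomogeneous 𝒜)
    {e : ℕ} (he : e ≠ 0)
    (hu : ∀ i : Fin m, ∃ w ∈ 𝒜 (e • (Pi.single i 1 : Fin m → ℤ)), IsUnit (Ideal.Quotient.mk P w))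
    (hdim : ringKrullDim (A ⧸ P) ≤ m) :
    ∀ ⦃a : A⦄, a ∈ 𝒜 0 → a ∉ P → IsUnit (Ideal.Quotient.mk P a) := by
  intro a ha haP
  set A₀ : Subring A := SetLike.GradeZero.subring 𝒜 with hA₀
  set P₀ : Ideal A₀ := P.comap A₀.subtype with hP₀
  haveI : P₀.IsPrime := Ideal.comap_isPrime _ _
  haveI : IsDomain (A₀ ⧸ P₀) := Ideal.Quotient.isDomain P₀
  have h := ringKrullDim_gradeZero_quotient_add_le 𝒜 P hP he hu
  -- `dim (A₀ ⧸ P₀) ≤ 0`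
  have hle0 : ringKrullDim (A₀ ⧸ P₀) ≤ 0 := by
    have h' : ringKrullDim (A₀ ⧸ P₀) + m ≤ (m : WithBot ℕ∞) := h.trans hdim
    -- cancel the finite summand `m`
    rcases hd : ringKrullDim (A₀ ⧸ P₀) with _ | d
    · exact bot_le
    · rw [hd] at h'
      have h'' : d + m ≤ (m : ℕ∞) := by
        have h3 : ((d + m : ℕ∞) : WithBot ℕ∞) ≤ ((m : ℕ∞) : WithBot ℕ∞) := by
          rw [WithBot.coe_add]
          exact h'
        exact WithBot.coe_le_coe.mp h3
      have h4 : d + m ≤ 0 + (m : ℕ∞) := by rwa [zero_add]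
      have h5 : d ≤ 0 := (WithTop.add_le_add_iff_right (WithTop.natCast_ne_top m)).mp h4
      exact WithBot.coe_le_coe.mpr h5
  haveI : Ring.KrullDimLE 0 (A₀ ⧸ P₀) := by
    rw [Ring.KrullDimLE, Order.krullDimLE_iff]
    exact_mod_cast hle0
  have hfield : IsField (A₀ ⧸ P₀) := Ring.KrullDimLE.isField_of_isDomain
  -- `a` is a unit in the field `A₀ ⧸ P₀`
  have ha0 : (Ideal.Quotient.mk P₀ ⟨a, ha⟩ : A₀ ⧸ P₀) ≠ 0 := by
    rw [Ne, Ideal.Quotient.eq_zero_iff_mem, hP₀, Ideal.mem_comap]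
    exact haP
  obtain ⟨b, hb⟩ := hfield.mul_inv_cancel ha0
  have hunit : IsUnit (Ideal.Quotient.mk P₀ ⟨a, ha⟩ : A₀ ⧸ P₀) := IsUnit.of_mul_eq_one b hb
  have hmap := hunit.map (Ideal.quotientMap P A₀.subtype le_rfl)
  rw [Ideal.quotientMap_mk] at hmap
  exact hmap

/-- **Closed orbits from the dimension count (clause (I2) of `ELadderOne.Stage.Inv` from (I1)).**  Let `𝒜` be
a `ℤᵐ`-grading of the commutative ring `A` (a torus chart), `P` a homogeneous prime, `e ≠ 0`, and suppose
there are homogeneous units modulo `P` of EVERY degree `e • χ` (`GradedAtlas.exists_unit` read on the orbit,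
via `isUnit_quotient_mk_of_isUnit_map`).  If `dim (A ⧸ P) ≤ m` then `A ⧸ P` is GRADED-SIMPLE: every
homogeneous element outside `P` is a unit modulo `P` (the degree-`0` classes form a field by
`isUnit_quotient_mk_of_degreeZero`, then res-type-047's `gradedSimple_of_degreeZero_of_units`).  Geometric
content: an `m`-dimensional orbit closure of an `m`-torus acting with finite stabilisers is the orbit itself.
[folklore] -/
theorem gradedSimple_of_ringKrullDim_le (P : Ideal A) [P.IsPrime] (hP : P.IsHomogeneous 𝒜)
    {e : ℕ} (he : e ≠ 0)
    (hu : ∀ χ : Fin m → ℤ, ∃ w ∈ 𝒜 (e • χ), IsUnit (Ideal.Quotient.mk P w))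
    (hdim : ringKrullDim (A ⧸ P) ≤ m) :
    ∀ (χ : Fin m → ℤ) ⦃a : A⦄, a ∈ 𝒜 χ → a ∉ P → IsUnit (Ideal.Quotient.mk P a) :=
  gradedSimple_of_degreeZero_of_units 𝒜
    (isUnit_quotient_mk_of_degreeZero 𝒜 P hP he (fun _ => hu _) hdim) he hu

/-- The same with the dimension hypothesis as an EQUALITY `dim (A ⧸ P) = m` (the form in which (I1) + the
ambient dimension deliver it), recording also the lower bound `m ≤ dim (A ⧸ P)` that makes the equality the
only possibility (`le_ringKrullDim_quotient`). [folklore] -/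
theorem gradedSimple_of_ringKrullDim_eq (P : Ideal A) [P.IsPrime] (hP : P.IsHomogeneous 𝒜)
    {e : ℕ} (he : e ≠ 0)
    (hu : ∀ χ : Fin m → ℤ, ∃ w ∈ 𝒜 (e • χ), IsUnit (Ideal.Quotient.mk P w))
    (hdim : ringKrullDim (A ⧸ P) = m) :
    ∀ (χ : Fin m → ℤ) ⦃a : A⦄, a ∈ 𝒜 χ → a ∉ P → IsUnit (Ideal.Quotient.mk P a) :=
  gradedSimple_of_ringKrullDim_le 𝒜 P hP he hu hdim.le

end TorusChartDim

end Summit.ResolutionOfSingularities.ResolutionOfSingularities.Theorems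

end
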